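import Literature.AlgebraicGeometry.Resolution.NormallyFlatGenericRegular
import Literature.AlgebraicGeometry.Resolution.RegularLocalRingsUFD
import Literature.AlgebraicGeometry.Resolution.RegularLocalRingsQuotient
import Literature.AlgebraicGeometry.Resolution.RegularCentreRsopPart
import Literature.AlgebraicGeometry.Resolution.RsopLocalization
import Literature.AlgebraicGeometry.Resolution.StalkIdealLemmas
import Literature.AlgebraicGeometry.Resolution.PrimeDivisorIdeals
import Literature.AlgebraicGeometry.Resolution.StalkSpecializesLocalization
import Literature.AlgebraicGeometry.Resolution.StrictNormalCrossingsFlatDescent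
import Literature.RingTheory.HilbertSamuel.PsiSemicontinuity
import Mathlib.RingTheory.Ideal.KrullsHeightTheorem
import HarnessLib

/-!
# A hypersurface is regular along a permissible centre through a point of order one
# (the regular host along a weight-one centre; Cossart–Jannsen–Saito 2020, Def. 3.1 / Thm. 3.3)

Topic: `Literature/AlgebraicGeometry/Resolution`. Let `S` be a regular local ring, `P` a prime of
`S` with a localization `S_P`, and `g ∈ P`. Suppose the image of `g` in `S_P` has ORDER ONE
(`g ∉ 𝔪_{S_P}²`: the hypersurface `V(g)` is regular at the generic point of the centre `V(P)`) and
the centre `P/√(g)` is PERMISSIBLE (CJS Def. 3.1: regular, normally flat, in no minimal prime) in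
the REDUCED hypersurface ring `S/√(g)`. Then `g ∉ 𝔪_S²`: the hypersurface is regular (of order one)
at the closed point as well, and `(g)` is its own radical there. Proof: Bennett's criterion along the
permissible centre (`Ideal.IsPermissible.isRegularLocalRing_of_isRegularLocalRing_localization`,
`NormallyFlatGenericRegular.lean`) makes `S/√(g)` regular; by Matsumura 14.2 and Krull's principal
ideal theorem `√(g) = (h)` with `h ∉ 𝔪²`, and `g = u·h` with `u` a unit because a further prime factor
of `g` would put the image of `g` into `𝔪_{S_P}²` (unique factorization in `S`, Auslander–Buchsbaum).
The scheme-level form reads the hypotheses at a specialization `η ⤳ z` (`η` the generic point of the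
centre). Used on the E-side of the res-hironaka chain W5.2 (T5-E «W₂B-maxweight»: the host of the
controlled transform is regular along every weight-one centre). PROVED, no definitions, no named facts.

* `not_mem_sq_of_isPermissible_radical` — the ring statement;
* `not_stalkIdeal_le_sq_of_isPermissible` — on a scheme: for `η ⤳ z`, an ideal sheaf `𝓗` principal at
  `z`, of order `≤ 1` at `η ∈ Supp 𝓗`, whose reduced zero-scheme admits the centre `C` (with
  `C_z = 𝔭_η`) as a permissible centre at `z`, one has `ord_z 𝓗 ≤ 1` and `𝓗_z ⊆ C_z`.

## Sources

* V. Cossart, U. Jannsen, S. Saito, *Desingularization: Invariants and Strategy*, LNM 2270 (2020),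
  Def. 3.1, Thm. 3.3. [CossartJannsenSaito2020]
* H. Matsumura, *Commutative Ring Theory* (1986), Thm. 14.2, Thm. 20.3. [Matsumura1987]
-/

noncomputable section

open IsLocalRing

namespace Literature.AlgebraicGeometry.Resolution

universe u v

/-! ## Ring form -/

/-- **A hypersurface of order one at the generic point of a permissible centre has order one at the
closed point.** `S` regular local, `P` prime, `S_P` a localization at `P`, `g ∈ P` with
`g ∉ 𝔪_{S_P}²`, and `P/√(g)` permissible in `S/√(g)` (CJS Def. 3.1) ⇒ `g ∉ 𝔪_S²`.
[cite: CossartJannsenSaito2020, Def. 3.1 and Thm. 3.3] [cite: Matsumura1987, Thm. 14.2 and Thm. 20.3] -/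
theorem not_mem_sq_of_isPermissible_radical {S : Type u} [CommRing S] [IsRegularLocalRing S]
    {P : Ideal S} [P.IsPrime] (Sp : Type v) [CommRing Sp] [Algebra S Sp]
    [IsLocalization.AtPrime Sp P] [IsRegularLocalRing Sp] {g : S} (hgP : g ∈ P)
    (hg2 : algebraMap S Sp g ∉ maximalIdeal Sp ^ 2)
    (hperm : (P.map (Ideal.Quotient.mk (Ideal.span {g}).radical)).IsPermissible) :
    g ∉ maximalIdeal S ^ 2 := by
  classical
  haveI : IsLocalRing Sp := IsLocalization.AtPrime.isLocalRing Sp P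
  set J : Ideal S := (Ideal.span {g}).radical with hJdef
  have hJP : J ≤ P :=
    (Ideal.IsPrime.radical_le_iff ‹_›).mpr ((Ideal.span_singleton_le_iff_mem _).mpr hgP)
  have hP𝔪 : P ≤ maximalIdeal S := IsLocalRing.le_maximalIdeal (Ideal.IsPrime.ne_top ‹_›)
  have hJ𝔪 : J ≤ maximalIdeal S := hJP.trans hP𝔪
  have hg0 : g ≠ 0 := by
    rintro rfl
    exact hg2 (by rw [map_zero]; exact zero_mem _)
  have hgJ : g ∈ J := Ideal.le_radical (Ideal.mem_span_singleton_self g)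
  -- in `S_P` the image of `g` is a regular parameter: `J S_P = (g')` is prime, `S_P/J S_P` regular
  set g' : Sp := algebraMap S Sp g with hg'def
  have hg'𝔪 : g' ∈ maximalIdeal Sp := (IsLocalization.AtPrime.to_map_mem_maximal_iff Sp P g).mpr hgP
  have hreg' : IsRegularLocalRing (Sp ⧸ Ideal.span {g'}) :=
    (IsRegularLocalRing.quotient_span_singleton hg'𝔪 hg2).1
  have hprime' : Prime g' := IsRegularLocalRing.prime_of_not_mem_sq hg'𝔪 hg2
  have hJmap : J.map (algebraMap S Sp) = Ideal.span {g'} := by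
    rw [hJdef, IsLocalization.map_radical P.primeCompl Sp, Ideal.map_span, Set.image_singleton,
      Ideal.IsPrime.radical]
    exact (Ideal.span_singleton_prime hprime'.ne_zero).mpr hprime'
  haveI hregJ' : IsRegularLocalRing (Sp ⧸ J.map (algebraMap S Sp)) := by
    haveI := hreg'
    exact IsRegularLocalRing.of_ringEquiv (Ideal.quotEquivOfEq hJmap.symm)
  -- `S_P/J S_P` is the localization of `S/J` at `P/J`
  haveI hPJ : (P.map (Ideal.Quotient.mk J)).IsPrime := Ideal.isPrime_map_quotientMk_of_isPrime hJP
  haveI : IsLocalization.AtPrime (Sp ⧸ J.map (algebraMap S Sp)) (P.map (Ideal.Quotient.mk J)) := by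
    have hinst : IsLocalization (Algebra.algebraMapSubmonoid (S ⧸ J) P.primeCompl)
        (Sp ⧸ J.map (algebraMap S Sp)) := inferInstance
    rwa [Literature.RingTheory.HilbertSamuel.algebraMapSubmonoid_quotient_primeCompl S P hJP]
      at hinst
  -- Bennett's criterion along the permissible centre: `S/J` is regular
  haveI : IsLocalRing (S ⧸ J) :=
    isLocalRing_quotient fun hJ => (maximalIdeal.isMaximal S).ne_top (top_le_iff.mp (hJ ▸ hJ𝔪))
  haveI hregJ : IsRegularLocalRing (S ⧸ J) :=
    hperm.isRegularLocalRing_of_isRegularLocalRing_localization (P.map (Ideal.Quotient.mk J))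
      (Sp ⧸ J.map (algebraMap S Sp))
  -- `J` is generated by ONE regular parameter (Matsumura 14.2 + Krull's principal ideal theorem)
  obtain ⟨r, c, hc, hcJ⟩ := exists_isRsopPart_span_range_eq hJ𝔪
  haveI hJprime : J.IsPrime := hcJ ▸ hc.isPrime_span_range
  have hheight : J.height = r := by rw [← hcJ]; exact hc.height_span_range
  have hmin : J ∈ (Ideal.span {g}).minimalPrimes := by
    rw [← Ideal.radical_minimalPrimes]
    change J ∈ J.minimalPrimes
    rw [Ideal.minimalPrimes_eq_subsingleton_self]
    exact Set.mem_singleton J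
  have hle1 : J.height ≤ 1 :=
    Ideal.height_le_one_of_isPrincipal_of_mem_minimalPrimes (Ideal.span {g}) J hmin
  have hr1 : r ≤ 1 := by
    rw [hheight] at hle1
    exact_mod_cast hle1
  have hr0 : r ≠ 0 := by
    rintro rfl
    have hbot : J = ⊥ := by
      rw [← hcJ, Set.range_eq_empty, Ideal.span_empty]
    exact hg0 ((Submodule.mem_bot S).mp (hbot ▸ hgJ))
  obtain rfl : r = 1 := by omega
  set h : S := c 0 with hhdef
  have hrange : Set.range c = {h} := by
    ext a
    simp only [Set.mem_range, Set.mem_singleton_iff, Fin.exists_fin_one, hhdef, eq_comm]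
  have hJh : J = Ideal.span {h} := by rw [← hcJ, hrange]
  have hh2 : h ∉ maximalIdeal S ^ 2 := hc.not_mem_sq 0
  have hhprime : Prime h := hc.prime 0
  have hhP : h ∈ P := hJP (hJh ▸ Ideal.mem_span_singleton_self h)
  -- `g = g₁ h` with `g₁` a unit: a prime factor of `g₁` would force `g' ∈ 𝔪_{S_P}²`
  rw [hJh] at hgJ
  obtain ⟨g₁, hg₁⟩ := Ideal.mem_span_singleton'.mp hgJ
  have hg₁unit : IsUnit g₁ := by
    by_contra hu
    haveI := isDomain_of_isRegularLocalRing S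
    haveI := IsRegularLocalRing.uniqueFactorizationMonoid S
    have hg₁0 : g₁ ≠ 0 := by
      rintro rfl
      exact hg0 (by rw [← hg₁, zero_mul])
    obtain ⟨p, hpirr, hpdvd⟩ := WfDvdMonoid.exists_irreducible_factor hu hg₁0
    have hp : Prime p := UniqueFactorizationMonoid.irreducible_iff_prime.mp hpirr
    have hpg : p ∣ g := hpdvd.trans (Dvd.intro h hg₁)
    have hJp : J ≤ Ideal.span {p} := by
      rw [hJdef, Ideal.IsPrime.radical_le_iff ((Ideal.span_singleton_prime hp.ne_zero).mpr hp),
        Ideal.span_singleton_le_iff_mem, Ideal.mem_span_singleton]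
      exact hpg
    have hph : p ∣ h := by
      rw [← Ideal.mem_span_singleton]
      exact hJp (hJh ▸ Ideal.mem_span_singleton_self h)
    have hassoc : Associated p h := hpirr.associated_of_dvd hhprime.irreducible hph
    obtain ⟨g₂, hg₂⟩ := hassoc.symm.dvd.trans hpdvd
    apply hg2
    have hfac : g = h * h * g₂ := by rw [← hg₁, hg₂]; ring
    have hh' : algebraMap S Sp h ∈ maximalIdeal Sp :=
      (IsLocalization.AtPrime.to_map_mem_maximal_iff Sp P h).mpr hhP
    rw [hg'def, hfac, map_mul, map_mul, pow_two]
    exact Ideal.mul_mem_right _ _ (Ideal.mul_mem_mul hh' hh')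
  -- conclude
  intro hg𝔪2
  apply hh2
  obtain ⟨u, rfl⟩ := hg₁unit
  have hhu : h = ↑u⁻¹ * g := by
    rw [← hg₁, ← mul_assoc, Units.inv_mul, one_mul]
  rw [hhu]
  exact Ideal.mul_mem_left _ _ hg𝔪2

/-! ## On a scheme -/

open _root_.CategoryTheory _root_.AlgebraicGeometry _root_.TopologicalSpace

variable {X : Scheme.{u}}

/-- **The host is regular along a permissible centre (scheme form).** Let `η ⤳ z` be a
specialization with regular local rings, `𝓗` an ideal sheaf principal at `z` with `η ∈ Supp 𝓗` and
`ord_η 𝓗 ≤ 1` (`𝓗_η ⊄ 𝔪_η²`), and `C` an ideal sheaf with `C_z = 𝔭_η` (the centre is the closure of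
`η` near `z`) which is a PERMISSIBLE centre at `z` for the reduced zero-scheme of `𝓗`
(`(C_z + √𝓗_z)/√𝓗_z` permissible in `𝒪_{X,z}/√𝓗_z`, CJS Def. 3.1 — the per-step clause of
`IsBPermissibleSequenceB`). Then `ord_z 𝓗 ≤ 1` (`𝓗_z ⊄ 𝔪_z²`) and `𝓗_z ⊆ C_z`: a local generator of
`𝓗` at `z` is a regular parameter vanishing on the centre.
[cite: CossartJannsenSaito2020, Def. 3.1 and Thm. 3.3] [cite: Matsumura1987, Thm. 14.2] -/
theorem not_stalkIdeal_le_sq_of_isPermissible {𝓗 C : X.IdealSheafData} {η z : X} (hηz : η ⤳ z)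
    [IsRegularLocalRing (X.presheaf.stalk z)] [IsRegularLocalRing (X.presheaf.stalk η)]
    (h𝓗z : ∃ g, stalkIdeal 𝓗 z = Ideal.span {g})
    (hCz : stalkIdeal C z = primeOfSpecializes hηz)
    (hperm : ((stalkIdeal C z).map
      (Ideal.Quotient.mk (stalkIdeal 𝓗.radical z))).IsPermissible)
    (hηH : η ∈ 𝓗.support)
    (hord : ¬ stalkIdeal 𝓗 η ≤ maximalIdeal (X.presheaf.stalk η) ^ 2) :
    ¬ stalkIdeal 𝓗 z ≤ maximalIdeal (X.presheaf.stalk z) ^ 2 ∧ stalkIdeal 𝓗 z ≤ stalkIdeal C z := by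
  obtain ⟨g, hg⟩ := h𝓗z
  letI alg := (X.presheaf.stalkSpecializes hηz).hom.toAlgebra
  haveI : (primeOfSpecializes hηz).IsPrime := Ideal.IsPrime.comap _
  haveI : IsLocalization.AtPrime (X.presheaf.stalk η) (primeOfSpecializes hηz) :=
    isLocalizationAtPrime_stalkSpecializes hηz
  have halg : algebraMap (X.presheaf.stalk z) (X.presheaf.stalk η) =
      (X.presheaf.stalkSpecializes hηz).hom := RingHom.algebraMap_toAlgebra _
  -- `𝓗_η = (φ g)`
  have hη : stalkIdeal 𝓗 η = Ideal.span {algebraMap _ (X.presheaf.stalk η) g} := by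
    rw [← stalkIdeal_map_stalkSpecializes 𝓗 hηz, hg, Ideal.map_span, Set.image_singleton, halg]
  have hgP : g ∈ primeOfSpecializes hηz := by
    change (X.presheaf.stalkSpecializes hηz).hom g ∈ maximalIdeal _
    rw [← halg]
    exact (mem_support_iff_stalkIdeal_le 𝓗 η).mp hηH (hη ▸ Ideal.mem_span_singleton_self _)
  have hg2 : algebraMap _ (X.presheaf.stalk η) g ∉ maximalIdeal (X.presheaf.stalk η) ^ 2 :=
    fun h2 => hord (hη ▸ (Ideal.span_singleton_le_iff_mem _).mpr h2)
  have hrad : stalkIdeal 𝓗.radical z = (Ideal.span {g}).radical := by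
    rw [stalkIdeal_radical, hg]
  rw [hCz, hrad] at hperm
  have key := not_mem_sq_of_isPermissible_radical (X.presheaf.stalk η) hgP hg2 hperm
  refine ⟨fun hle => key (hle (hg ▸ Ideal.mem_span_singleton_self g)), ?_⟩
  rw [hg, hCz, Ideal.span_singleton_le_iff_mem]
  exact hgP

end Literature.AlgebraicGeometry.Resolution

end
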